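import Mathlib
import HarnessLib
import Summits.HubbardSuperconductivity.HubbardSuperconductivity.Theorems.KLProgrammeKLRegimeSplitBundleV15

/-!
# Route `KLProgramme` — crux K3 `KLRegimeTwoPointLimit` (stmt-HubbardSuperconductivity-19937): the GEN-6 bundle `klPredsV16`
# = `klPredsV15` with the (E3f-A) antecedent made THRESHOLD-PARAMETRIC (T1d-T) — cell gate-hubbard-kl, seat p2 g9 = bundle typist;
# plan g14 RULING (R18) STATUS 2026-08-27T06:46:01Z (text of record = k3c3-p2 g5's T1d-T VERBATIM; append-only NEW module, `…SplitBundleV15` untouched)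

V15 DEFECT (k3c3-p2 g5 l.2133, author k3c4-p1 g6 concurs l.2160, ref-4 / kl-ref REAL, machine evidence MockV16 99a3234e5490639a): `TwoLegVolumeRateA`'s
antecedent asks the history at every volume `L'' ≥ L` down to the Matsubara floor `Q.M0 β L''`, but its one consumer (child 2's scale-major volume
transfer) knows the history only above its OWN floor `max (Mh L'') (Q.M0 β L'')` for an adversarial `Mh` — consumer-undischargeable as typed (Δ14 class).
REPAIR T1d-T: the antecedent is asked only at or above a READER-SUPPLIED cutoff threshold `Mq`:

* `TwoLegVolumeRateAT hist Q β U μ K n := ∀ Mq : ℕ → ℕ, Q.M0 β L ≤ M → Mq L ≤ M → (∀ L'' M'', L ≤ L'' → Q.M0 β L'' ≤ M'' → Mq L'' ≤ M'' → ∀ j < n,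
  hist L'' M'' K j) → ∀ L' M', L ≤ L' → Q.M0 β L' ≤ M' → Mq L' ≤ M' → ∀ θ, |klLocalPart L M … n θ − klLocalPart L' M' … n θ| ≤ Q.CL β n / L`;
* `TwoLegStepV16 := TwoLegCoreTD histV15 ∧ TwoLegSizesMSTQ ∧ TwoLegVolumeRateAT (histV15 ∧ TwoLegCoreTD histV15 ∧ TwoLegSizesMSTQ)` (order kept; the comparison
  history stays `histV15` = `split ∧ renorm ∧ engine` of this bundle — NO `histV16`);
* `klPredsV16 := { frameOK := FrameOKDeg, renorm := RenormalisedAtF, split := BetaSplitAtS2, engine := EngineBoundsAtV10S, twoLeg := TwoLegStepV16 }`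
  (= `{ klPredsV15 with twoLeg := TwoLegStepV16 }`, `klPredsV16_eq_with` is `rfl`).
`FrameOKDeg`, `klFrameDeg`, `FrameLipschitzFnTD`, `TwoLegCoreTD`, `msBarQ`, `TwoLegSizesMSFnQ/MSTQ`, `histV15`, the Nyquist guard and the exact-reproduction
lemmas stay in `…SplitBundleV15` (p505393) and are imported.  Pin (b) of the re-sign conditions: `twoLegVolumeRateA_of_AT` (T1d-T at `Mq := fun _ => 0` ⇒ the
landed T1d clause), hence `twoLegStepV15_of_V16`.  Children of gen 6: `EngineP4 | BetaSplitP | CountertermP2 | VolumeLimitP2 (FinalTwoLegVolLimitEx) |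
TwoPointAssemblyP3 (FinalTwoLegVolLimitEx)` on `klPredsV16 klWindowC`; consumer of (E3f-AT): child 2 with `Mq := fun L => max (Mh L) (Q.M0 β L)`
(`twoLegVolumeRateAT_apply_of_V16`).  Definitions (+ bookkeeping) only; nothing about the model is asserted; no engine stub is proved here; nothing asserts
superconductivity.
-/

noncomputable section

namespace Summit.HubbardSuperconductivity.HubbardSuperconductivity.Theorems.KLRegimeSplit

set_option linter.dupNamespace false -- summit = problem name (single-conjunct summit), D-0017

open Real Finset Literature.MathematicalPhysics.QuantumLattice Literature.Probability.LatticeModels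
open Literature.MathematicalPhysics.QuantumLattice.FermiRG
open Summit.HubbardSuperconductivity.HubbardSuperconductivity.Theorems.KLProgrammeLegKernels

/-! ## §1 (T1d-T) the threshold-parametric two-volume rate, the two-leg slot, the bundle -/

section Model

variable (L M : ℕ) [NeZero L] [NeZero M]

/-- **(T1d-T) (E3f-AT) the two-volume rate with the history at every volume from `L` up, ABOVE A READER-SUPPLIED CUTOFF THRESHOLD `Mq`**
(k3c3-p2 g5's text verbatim, plan g14 (R18)): for every `Mq : ℕ → ℕ`, if this volume clears `Q.M0 β L` and `Mq L`, and the history below `n` holds at every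
`(L'', M'')` with `L ≤ L''`, `Q.M0 β L'' ≤ M''`, `Mq L'' ≤ M''`, then the rate holds against every comparison volume clearing the same two thresholds. -/
def TwoLegVolumeRateAT (hist : (L' M' : ℕ) → [NeZero L'] → [NeZero M'] → TrigPolyC4v → ℕ → Prop) (Q : EngConsts) (β U μ : ℝ)
    (K : TrigPolyC4v) (n : ℕ) : Prop :=
  ∀ Mq : ℕ → ℕ, Q.M0 β L ≤ M → Mq L ≤ M →
    (∀ (L'' M'' : ℕ) [NeZero L''] [NeZero M''], L ≤ L'' → Q.M0 β L'' ≤ M'' → Mq L'' ≤ M'' → ∀ j < n, hist L'' M'' K j) →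
      ∀ (L' M' : ℕ) [NeZero L'] [NeZero M'], L ≤ L' → Q.M0 β L' ≤ M' → Mq L' ≤ M' →
        ∀ θ : ℝ, |klLocalPart L M β U μ K n θ - klLocalPart L' M' β U μ K n θ| ≤ Q.CL β n / L

/-- **`TwoLegStepV16 … G P Q R K n`** := `TwoLegCoreTD histV15 ∧ TwoLegSizesMSTQ ∧ TwoLegVolumeRateAT (histV15 ∧ TwoLegCoreTD histV15 ∧ TwoLegSizesMSTQ)` —
`TwoLegStepV15` with the (E3f) conjunct `TwoLegVolumeRateA ↦ TwoLegVolumeRateAT`, nothing else (order kept).  Same slot type as `Preds.twoLeg`. -/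
def TwoLegStepV16 (G : GeoConsts) (P : SplitConsts) (Q : EngConsts) (R : RenConsts) (β U μ : ℝ) (K : TrigPolyC4v) (n : ℕ) :
    Prop :=
  TwoLegCoreTD L M (histV15 L M G P Q R β U μ) G P Q R β U μ K n ∧ TwoLegSizesMSTQ L M G Q R β U μ K n ∧
    TwoLegVolumeRateAT L M
      (fun L'' M'' _ _ K' j => histV15 L'' M'' G P Q R β U μ K' j ∧
        TwoLegCoreTD L'' M'' (histV15 L'' M'' G P Q R β U μ) G P Q R β U μ K' j ∧ TwoLegSizesMSTQ L'' M'' G Q R β U μ K' j)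
      Q β U μ K n

end Model

/-- **`klPredsV16 : Preds`** — the LITERAL `{ frameOK := FrameOKDeg, renorm := RenormalisedAtF, split := BetaSplitAtS2, engine := EngineBoundsAtV10S,
twoLeg := TwoLegStepV16 }` (= `{ klPredsV15 with twoLeg := TwoLegStepV16 }`, §2 `klPredsV16_eq_with`).  Children of gen 6:
`EngineP4 | BetaSplitP | CountertermP2 | VolumeLimitP2 (FinalTwoLegVolLimitEx) | TwoPointAssemblyP3 (FinalTwoLegVolLimitEx)` on `klPredsV16 klWindowC`. -/
def klPredsV16 : Preds where
  frameOK := FrameOKDeg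
  renorm := fun L M _ _ β U μ K R n => RenormalisedAtF L M β U μ K R n
  split := fun L M _ _ G P Q β U μ K n => BetaSplitAtS2 L M G P Q β U μ K n
  engine := fun L M _ _ G P Q β U μ K n => EngineBoundsAtV10S L M G P Q β U μ K n
  twoLeg := fun L M _ _ G P Q R β U μ K n => TwoLegStepV16 L M G P Q R β U μ K n

/-! ## §2 Bookkeeping (`rfl`-level) and the accessor interface -/

/-- V16 is V15 with the two-leg slot replaced (the ruling's spelling). -/
theorem klPredsV16_eq_with :
    klPredsV16 = { klPredsV15 with twoLeg := fun L M _ _ G P Q R β U μ K n => TwoLegStepV16 L M G P Q R β U μ K n } := rfl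

/-- V16's frame class is `FrameOKDeg` (= V15's). -/
theorem klPredsV16_frameOK_apply : klPredsV16.frameOK = FrameOKDeg := rfl

/-- V16's frame class IS V15's. -/
theorem klPredsV16_frameOK : klPredsV16.frameOK = klPredsV15.frameOK := rfl

/-- V16's frame class, applied and unfolded to the numeral (`Iff.rfl`). -/
theorem klPredsV16_frameOK_iff (R : RenConsts) (U : ℝ) (N : ℕ) (μ : ℝ) (K : TrigPolyC4v) :
    klPredsV16.frameOK R U N μ K ↔ FrameOK R U N μ K ∧ K.degree ≤ 2 ^ 21 * 16 ^ N := Iff.rfl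

/-- `klPredsV16.frameOK` implies `klPredsV14.frameOK` (= `FrameOK`) pointwise. -/
theorem klPredsV16_frameOK_imp (R : RenConsts) (U : ℝ) (N : ℕ) (μ : ℝ) (K : TrigPolyC4v) (h : klPredsV16.frameOK R U N μ K) :
    klPredsV14.frameOK R U N μ K := h.1

/-- V16's engine slot IS V15's (`EngineBoundsAtV10S`). -/
theorem klPredsV16_engine : klPredsV16.engine = klPredsV15.engine := rfl

/-- V16's engine slot, applied: `EngineBoundsAtV10S`. -/
theorem klPredsV16_engine_apply (L M : ℕ) [NeZero L] [NeZero M] (G : GeoConsts) (P : SplitConsts) (Q : EngConsts) (β U μ : ℝ)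
    (K : TrigPolyC4v) (n : ℕ) : klPredsV16.engine L M G P Q β U μ K n = EngineBoundsAtV10S L M G P Q β U μ K n := rfl

/-- V16's split slot, applied. -/
theorem klPredsV16_split_apply (L M : ℕ) [NeZero L] [NeZero M] (G : GeoConsts) (P : SplitConsts) (Q : EngConsts) (β U μ : ℝ)
    (K : TrigPolyC4v) (n : ℕ) : klPredsV16.split L M G P Q β U μ K n = BetaSplitAtS2 L M G P Q β U μ K n := rfl

/-- V16's renormalisation slot, applied. -/
theorem klPredsV16_renorm_apply (L M : ℕ) [NeZero L] [NeZero M] (β U μ : ℝ) (K : TrigPolyC4v) (R : RenConsts) (n : ℕ) :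
    klPredsV16.renorm L M β U μ K R n = RenormalisedAtF L M β U μ K R n := rfl

/-- V16's two-leg slot is `TwoLegStepV16`. -/
theorem klPredsV16_twoLeg_apply (L M : ℕ) [NeZero L] [NeZero M] (G : GeoConsts) (P : SplitConsts) (Q : EngConsts) (R : RenConsts)
    (β U μ : ℝ) (K : TrigPolyC4v) (n : ℕ) :
    klPredsV16.twoLeg L M G P Q R β U μ K n = TwoLegStepV16 L M G P Q R β U μ K n := rfl

section Model

variable {L M : ℕ} [NeZero L] [NeZero M] {G : GeoConsts} {P : SplitConsts} {Q : EngConsts} {R : RenConsts} {β U μ : ℝ}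
  {K : TrigPolyC4v} {n : ℕ}

/-- The thin two-leg step (capped (E3c), V15 history) is the first conjunct of the V16 slot. -/
theorem twoLegCoreTD_of_twoLegStepV16 (h : TwoLegStepV16 L M G P Q R β U μ K n) :
    TwoLegCoreTD L M (histV15 L M G P Q R β U μ) G P Q R β U μ K n := h.1

/-- (E3a-MS-TQ) is the second conjunct of the V16 slot. -/
theorem twoLegSizesMSTQ_of_twoLegStepV16 (h : TwoLegStepV16 L M G P Q R β U μ K n) : TwoLegSizesMSTQ L M G Q R β U μ K n := h.2.1

/-- The volume-rate conjunct (E3f-AT) with its V16 antecedent. -/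
theorem twoLegVolumeRateAT_of_twoLegStepV16 (h : TwoLegStepV16 L M G P Q R β U μ K n) :
    TwoLegVolumeRateAT L M
      (fun L'' M'' _ _ K' j => histV15 L'' M'' G P Q R β U μ K' j ∧
        TwoLegCoreTD L'' M'' (histV15 L'' M'' G P Q R β U μ) G P Q R β U μ K' j ∧ TwoLegSizesMSTQ L'' M'' G Q R β U μ K' j)
      Q β U μ K n := h.2.2

/-- Assemble the V16 slot from its three conjuncts (the engine's two-leg stubs deliver it in this shape). -/
theorem twoLegStepV16_of_conjuncts (h1 : TwoLegCoreTD L M (histV15 L M G P Q R β U μ) G P Q R β U μ K n)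
    (h2 : TwoLegSizesMSTQ L M G Q R β U μ K n)
    (h3 : TwoLegVolumeRateAT L M
      (fun L'' M'' _ _ K' j => histV15 L'' M'' G P Q R β U μ K' j ∧
        TwoLegCoreTD L'' M'' (histV15 L'' M'' G P Q R β U μ) G P Q R β U μ K' j ∧ TwoLegSizesMSTQ L'' M'' G Q R β U μ K' j)
      Q β U μ K n) :
    TwoLegStepV16 L M G P Q R β U μ K n := ⟨h1, h2, h3⟩

/-- Tier-1 sizes of the function piece straight from the V16 slot. -/
theorem norm_iteratedFDeriv_pieceFn_le_of_V16 (h : TwoLegStepV16 L M G P Q R β U μ K n) {j : ℕ} (hj : j ≤ 2) (q : Momentum) :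
    ‖iteratedFDeriv ℝ j (onM (klTwoLegPieceFn L M β U μ K.eval n)) q‖ ≤ twoLegBar G Q U j n :=
  h.1.tier1 hj q

/-- `HistP klPredsV16` at `j < n`, destructured into the four slots by `rfl`. -/
theorem histP_V16_apply (h : HistP klPredsV16 L M G P Q R β U μ K n) {j : ℕ} (hj : j < n) :
    BetaSplitAtS2 L M G P Q β U μ K j ∧ RenormalisedAtF L M β U μ K R j ∧ EngineBoundsAtV10S L M G P Q β U μ K j ∧
      TwoLegStepV16 L M G P Q R β U μ K j := h j hj

/-- **`HistP klPredsV16` below `n` yields the V15 history** (`split ∧ renorm ∧ engine` are V15's): `histV15 … K j` for every `j < n`. -/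
theorem histV15_of_histP_V16 (h : HistP klPredsV16 L M G P Q R β U μ K n) : ∀ j < n, histV15 L M G P Q R β U μ K j :=
  fun j hj => ⟨(h j hj).1, (h j hj).2.1, (h j hj).2.2.1⟩

/-- `HistP klPredsV16` below `n` yields the full (E3f-AT) antecedent triple of V16 at that volume. -/
theorem histRateV16_of_histP (h : HistP klPredsV16 L M G P Q R β U μ K n) :
    ∀ j < n, histV15 L M G P Q R β U μ K j ∧ TwoLegCoreTD L M (histV15 L M G P Q R β U μ) G P Q R β U μ K j ∧
      TwoLegSizesMSTQ L M G Q R β U μ K j := fun j hj =>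
  ⟨⟨(h j hj).1, (h j hj).2.1, (h j hj).2.2.1⟩, (h j hj).2.2.2.1, (h j hj).2.2.2.2.1⟩

/-- **V16's rate clause applies whenever every volume from `L` up, above the Matsubara floor AND the reader's threshold `Mq`, carries the V16 history
below `n`** — child 2's one-liner (its scale-major induction supplies `hhistAll` at `Mq := fun L => max (Mh L) (Q.M0 β L)`). -/
theorem twoLegVolumeRateAT_apply_of_V16 (h : TwoLegStepV16 L M G P Q R β U μ K n) (Mq : ℕ → ℕ) (hM : Q.M0 β L ≤ M) (hMq : Mq L ≤ M)
    (hhistAll : ∀ (L'' M'' : ℕ) [NeZero L''] [NeZero M''], L ≤ L'' → Q.M0 β L'' ≤ M'' → Mq L'' ≤ M'' →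
      HistP klPredsV16 L'' M'' G P Q R β U μ K n)
    {L' M' : ℕ} [NeZero L'] [NeZero M'] (hL : L ≤ L') (hM' : Q.M0 β L' ≤ M') (hMq' : Mq L' ≤ M') (θ : ℝ) :
    |klLocalPart L M β U μ K n θ - klLocalPart L' M' β U μ K n θ| ≤ Q.CL β n / L :=
  h.2.2 Mq hM hMq (fun L'' M'' _ _ hL'' hM'' hMq'' => histRateV16_of_histP (hhistAll L'' M'' hL'' hM'' hMq'')) L' M' hL hM' hMq' θ

end Model

/-! ## §3 Bridges: (E3f-AT) at `Mq := 0` is (E3f-A) (re-sign pin (b)); V16 step ⇒ V15 step; the V7-shaped (E3f) ⇒ (E3f-AT) -/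

section Bridge

variable {L M : ℕ} [NeZero L] [NeZero M] {G : GeoConsts} {P : SplitConsts} {Q : EngConsts} {R : RenConsts} {β U μ : ℝ}
  {K : TrigPolyC4v} {n : ℕ} {hist : (L' M' : ℕ) → [NeZero L'] → [NeZero M'] → TrigPolyC4v → ℕ → Prop}

/-- **Pin (b): T1d-T at the trivial threshold `Mq := fun _ => 0` is exactly the landed T1d clause** — `TwoLegVolumeRateAT ⇒ TwoLegVolumeRateA`. -/
theorem twoLegVolumeRateA_of_AT (h : TwoLegVolumeRateAT L M hist Q β U μ K n) : TwoLegVolumeRateA L M hist Q β U μ K n :=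
  fun hM hall L' M' _ _ hL hM' θ =>
    h (fun _ => 0) hM (Nat.zero_le _) (fun L'' M'' _ _ hL'' hM'' _ => hall L'' M'' hL'' hM'') L' M' hL hM' (Nat.zero_le _) θ

/-- **The V7-shaped (E3f) clause implies (E3f-AT)** (its antecedent asks the history at the comparison volume only, which the AT antecedent supplies). -/
theorem twoLegVolumeRateAT_of_twoLegVolumeRate (h : TwoLegVolumeRate L M hist Q β U μ K n) : TwoLegVolumeRateAT L M hist Q β U μ K n :=
  fun _ hM _ hall L' M' _ _ hL hM' hMq' θ => h hM L' M' hL hM' (hall L' M' hL hM' hMq') θ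

/-- **The V16 step implies the V15 step** (pin (b) on the third conjunct; the first two are identical). -/
theorem twoLegStepV15_of_V16 (h : TwoLegStepV16 L M G P Q R β U μ K n) : TwoLegStepV15 L M G P Q R β U μ K n :=
  ⟨h.1, h.2.1, twoLegVolumeRateA_of_AT h.2.2⟩

/-- The history of the V16 bundle implies the history of the V15 bundle (slot-wise: three identical slots and `twoLegStepV15_of_V16`). -/
theorem histP_V15_of_histP_V16 (h : HistP klPredsV16 L M G P Q R β U μ K n) : HistP klPredsV15 L M G P Q R β U μ K n :=
  fun j hj => ⟨(h j hj).1, (h j hj).2.1, (h j hj).2.2.1, twoLegStepV15_of_V16 (h j hj).2.2.2⟩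

end Bridge

end Summit.HubbardSuperconductivity.HubbardSuperconductivity.Theorems.KLRegimeSplit

end
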